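import Summits.QuantumAdvantage.QuantumAdvantage.Theorems.CubicForrelationNearExactIsExactTwelveLevelFiveOffP

/-!
# Crux `CubicForrelation.NearExactIsExact` (stmt-QuantumAdvantage-14043) — n = 12, a LEVEL-5 side in the GENERIC configuration (`4 ∣ e₅` off
  the odd hyperplane, `8 ∣ e₅ − σ₅` on it): the sign character sums vanish or have absolute value `≥ 1024`, on at most `8` frequencies

Certificate seat `b2b-cforr-cert` (gen 27).  HONEST FRAMING: finite-slice lemmas (standard axioms) about cubic Boolean pairs on 12 bits: the
radical machine of gens 15–23 (`fr_hsd`, `fr_radical_large`, coset character sums) run on the odd hyperplane `P = x₀ ⊕ V` of a level-5 side with the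
partner-free (H3)/(H4) of …TwelveLevelFiveOffP.  Bricks for the level-5 branches of the open window; NO value of `θ₁₂` claimed; NOT summit progress.

Setting.  Cubic `f, g`, `W_g = 32u'`, `P = {u' odd} = x₀ ⊕ V` (`#V = 2048`), `e₅ = u' − 2(−1)^f`, `hb x = [e₅(x) ≡ 3 (mod 4)]`, `σ₅ = sZ ∘ hb`,
GENERIC hypotheses: `4 ∣ e₅` off `P`, `8 ∣ e₅ − σ₅` on `P`, off-hyperplane energy `≤ 2047`.
* `tzl5_mod4`: `4 ∣ e₅ − σ₅` on `P`.  * `tzl5_hsd`: base-free second differences of `hb` on `P` ((H3), `fr_hsd`).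
* `tzl5_sigma_H4`: `8 ∣ Σ_{4-flat ⊂ P} σ₅` ((H4) for `e₅` and `e₅ ≡ σ₅ (mod 8)`).
* `tzl5_Shat_sq`: `M(y)² = 2048·S_R(y)` for `M(y) = Σ_{x∈P} σ₅(x)(−1)^{x·y}`, `R` the radical of the relative form, `S_R` its signed character
  sum (`d0_Shat_sq` on the 11-flat); `tzl5_SR`: `S_R ∈ {0, #R}`.
* `tzl5_M_sq`: `#R = 2^k` with `k ≥ 9` (`fr_radical_large`), hence `M(y) = 0` or `M(y)² ≥ 2^20`; `tzl5_M_support`: `M ≠ 0` on at most `8`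
  frequencies (Parseval `Σ M² = 2^23`).

References: MacWilliams–Sloane (1977) Ch. 13–15; C. Carlet (2021) §5.2; R. O'Donnell (2014) §1.4.  Axioms: the standard three.
-/

set_option linter.dupNamespace false -- D-0017: single-problem summit ⇒ `QuantumAdvantage.QuantumAdvantage` by design

noncomputable section

namespace Summit.QuantumAdvantage.QuantumAdvantage.Theorems.CubicForrelation.NearExactIsExact

open Finset
open Literature.Computability.QuantumComplexity
open Literature.Computability.QuantumComplexity.BuzetChailloux (bxor zeroVec bxor_bxor_cancel_left bxor_zeroVec zeroVec_bxor bxor_comm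
  bxor_self)
open Literature.Computability.QuantumComplexity.DerivativeWalsh (W sum_W_sq twist_bxor_left)
open Literature.Computability.QuantumComplexity.Simon (twist_eq_one_or twist_mul_self)

/-- On the odd hyperplane the level-5 residual is `≡ σ₅ (mod 4)`, `σ₅ = sZ [e₅ ≡ 3 (mod 4)]`. [folklore] -/
theorem tzl5_mod4 (f : (Fin (6 + 6) → Bool) → Bool) (u' : (Fin (6 + 6) → Bool) → ℤ) {x : Fin (6 + 6) → Bool} (hx : Odd (u' x)) :
    (4 : ℤ) ∣ (u' x - 2 * sZ (f x)) - sZ (decide ((u' x - 2 * sZ (f x)) % 4 = 3)) := by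
  have hodd : Odd (u' x - 2 * sZ (f x)) := Int.odd_sub.2 (iff_of_true hx ⟨sZ (f x), two_mul _⟩)
  have ho := Int.odd_iff.1 hodd
  by_cases h3 : (u' x - 2 * sZ (f x)) % 4 = 3
  · rw [decide_eq_true h3, show sZ true = -1 from rfl]; omega
  · rw [decide_eq_false h3, show sZ false = 1 from rfl]; omega

/-- **`hsd` on the odd hyperplane**: with `4 ∣ e₅` off `P`, the sign bit `hb` has base-free second differences along `V` on `P` ((H3) `tzl5_H3`
+ `fr_hsd`). [this work] -/
theorem tzl5_hsd (f g : (Fin (6 + 6) → Bool) → Bool) (hf : IsDegLeFun 3 f) (hg : IsDegLeFun 3 g)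
    (u' : (Fin (6 + 6) → Bool) → ℤ) (hu' : ∀ x, W (fun y => signOf (g y)) x = (2 : ℝ) ^ 5 * (u' x : ℝ))
    (V : Finset (Fin (6 + 6) → Bool)) (x₀ : Fin (6 + 6) → Bool) (h0 : zeroVec ∈ V) (hadd : ∀ a ∈ V, ∀ b ∈ V, bxor a b ∈ V)
    (hcardV : #V = 2048) (hP : (univ.filter fun x : Fin (6 + 6) → Bool => Odd (u' x)) = V.image (bxor x₀))
    (h4off : ∀ y, ¬ Odd (u' y) → (4 : ℤ) ∣ u' y - 2 * sZ (f y)) :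
    ∀ x, Odd (u' x) → ∀ p ∈ V, ∀ q ∈ V,
      decide ((u' (bxor (bxor x p) q) - 2 * sZ (f (bxor (bxor x p) q))) % 4 = 3) =
        (decide ((u' x - 2 * sZ (f x)) % 4 = 3) ^^ decide ((u' (bxor x p) - 2 * sZ (f (bxor x p))) % 4 = 3) ^^
          decide ((u' (bxor x q) - 2 * sZ (f (bxor x q))) % 4 = 3) ^^
          (decide ((u' x₀ - 2 * sZ (f x₀)) % 4 = 3) ^^ decide ((u' (bxor x₀ p) - 2 * sZ (f (bxor x₀ p))) % 4 = 3) ^^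
            decide ((u' (bxor x₀ q) - 2 * sZ (f (bxor x₀ q))) % 4 = 3) ^^ decide ((u' (bxor (bxor x₀ p) q) - 2 * sZ (f (bxor (bxor x₀ p) q))) % 4 = 3))) := by
  classical
  set e : (Fin (6 + 6) → Bool) → ℤ := fun x => u' x - 2 * sZ (f x) with hedef
  set hb : (Fin (6 + 6) → Bool) → Bool := fun x => decide (e x % 4 = 3) with hbdef
  have hx₀ : Odd (u' x₀) := by
    have : x₀ ∈ V.image (bxor x₀) := mem_image.2 ⟨zeroVec, h0, bxor_zeroVec x₀⟩
    rw [← hP] at this; exact (mem_filter.1 this).2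
  have hPV : ∀ x, Odd (u' x) → ∀ a ∈ V, Odd (u' (bxor x a)) := by
    intro x hx a ha
    have h := fl1_coset_vadd hadd hP (mem_filter.2 ⟨mem_univ _, hx⟩) ha
    exact (mem_filter.1 h).2
  have hVP : ∀ x, Odd (u' x) → bxor x₀ x ∈ V := fun x hx => fl1_coset_diff hP (mem_filter.2 ⟨mem_univ _, hx⟩)
  have H3 := tzl5_H3 f g hf hg u' hu' V x₀ h0 hadd hcardV hP h4off
  have H3σ : ∀ x, Odd (u' x) → ∀ a b c : Fin (6 + 6) → Bool, a ∈ V → b ∈ V → c ∈ V →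
      (4 : ℤ) ∣ ∑ ε : Fin 3 → Bool, sZ (hb (fun j => x j ^^ decide (Odd #(univ.filter fun i => ε i && (![a, b, c] : Fin 3 → Fin (6 + 6) → Bool) i j)))) := by
    intro x hx a b c ha hb' hc
    have hin : ∀ ε : Fin 3 → Bool, Odd (u' (fun j => x j ^^ decide (Odd #(univ.filter fun i => ε i && (![a, b, c] : Fin 3 → Fin (6 + 6) → Bool) i j)))) :=
      fun ε => fr_mem_flatPt3 V h0 (fun z => Odd (u' z)) hPV hx _ (fun i => by fin_cases i <;> assumption) ε
    have h := H3 x hx a b c ha hb' hc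
    have hk : ∀ ε : Fin 3 → Bool, ∃ k : ℤ, e (fun j => x j ^^ decide (Odd #(univ.filter fun i => ε i && (![a, b, c] : Fin 3 → Fin (6 + 6) → Bool) i j))) =
        sZ (hb (fun j => x j ^^ decide (Odd #(univ.filter fun i => ε i && (![a, b, c] : Fin 3 → Fin (6 + 6) → Bool) i j)))) + 4 * k := by
      intro ε
      obtain ⟨k, hk⟩ := tzl5_mod4 f u' (hin ε)
      exact ⟨k, by simp only [e, hb]; linarith⟩
    choose k hk using hk
    change (4 : ℤ) ∣ ∑ ε : Fin 3 → Bool, e (fun j => x j ^^ decide (Odd #(univ.filter fun i => ε i && (![a, b, c] : Fin 3 → Fin (6 + 6) → Bool) i j))) at h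
    rw [sum_congr rfl fun ε _ => hk ε, sum_add_distrib, ← mul_sum] at h
    exact (dvd_add_left (Dvd.intro _ rfl)).1 h
  exact fr_hsd V (fun z => Odd (u' z)) x₀ hx₀ hVP hb H3σ

/-- **`8 ∣ Σ_{4-flat ⊂ P} σ₅`** in the generic configuration (`4 ∣ e₅` off `P`, `8 ∣ e₅ − σ₅` on `P`, off-hyperplane energy `≤ 2047`). [this work] -/
theorem tzl5_sigma_H4 (f g : (Fin (6 + 6) → Bool) → Bool) (hf : IsDegLeFun 3 f) (hg : IsDegLeFun 3 g)
    (u' : (Fin (6 + 6) → Bool) → ℤ) (hu' : ∀ x, W (fun y => signOf (g y)) x = (2 : ℝ) ^ 5 * (u' x : ℝ))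
    (V : Finset (Fin (6 + 6) → Bool)) (x₀ : Fin (6 + 6) → Bool) (h0 : zeroVec ∈ V) (hadd : ∀ a ∈ V, ∀ b ∈ V, bxor a b ∈ V)
    (hcardV : #V = 2048) (hP : (univ.filter fun x : Fin (6 + 6) → Bool => Odd (u' x)) = V.image (bxor x₀))
    (h4off : ∀ y, ¬ Odd (u' y) → (4 : ℤ) ∣ u' y - 2 * sZ (f y))
    (hoff : ∑ y ∈ univ.filter (fun y : Fin (6 + 6) → Bool => ¬ Odd (u' y)), (u' y - 2 * sZ (f y)) ^ 2 ≤ 2047)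
    (h8on : ∀ x, Odd (u' x) → (8 : ℤ) ∣ u' x - 2 * sZ (f x) - sZ (decide ((u' x - 2 * sZ (f x)) % 4 = 3)))
    (x : Fin (6 + 6) → Bool) (hx : Odd (u' x)) (a₀ a₁ a₂ a₃ : Fin (6 + 6) → Bool) (ha₀ : a₀ ∈ V) (ha₁ : a₁ ∈ V) (ha₂ : a₂ ∈ V) (ha₃ : a₃ ∈ V) :
    (8 : ℤ) ∣ ∑ ε : Fin 4 → Bool, sZ (decide ((u' (fun j => x j ^^ decide (Odd #(univ.filter fun i =>
        ε i && (![a₀, a₁, a₂, a₃] : Fin 4 → Fin (6 + 6) → Bool) i j))) - 2 * sZ (f (fun j => x j ^^ decide (Odd #(univ.filter fun i =>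
        ε i && (![a₀, a₁, a₂, a₃] : Fin 4 → Fin (6 + 6) → Bool) i j))))) % 4 = 3)) := by
  classical
  set e : (Fin (6 + 6) → Bool) → ℤ := fun x => u' x - 2 * sZ (f x) with hedef
  set hb : (Fin (6 + 6) → Bool) → Bool := fun x => decide (e x % 4 = 3) with hbdef
  have hPV : ∀ x, Odd (u' x) → ∀ a ∈ V, Odd (u' (bxor x a)) := by
    intro x hx a ha
    have h := fl1_coset_vadd hadd hP (mem_filter.2 ⟨mem_univ _, hx⟩) ha
    exact (mem_filter.1 h).2
  have hin : ∀ ε : Fin 4 → Bool, Odd (u' (fun j => x j ^^ decide (Odd #(univ.filter fun i => ε i && (![a₀, a₁, a₂, a₃] : Fin 4 → Fin (6 + 6) → Bool) i j)))) :=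
    fun ε => fr_mem_flatPt4 V h0 (fun z => Odd (u' z)) hPV hx _ (fun i => by fin_cases i <;> assumption) ε
  have h8 := tzl5_H4 f g hf hg u' hu' V x₀ h0 hadd hcardV hP h4off hoff x hx a₀ a₁ a₂ a₃ ha₀ ha₁ ha₂ ha₃
  change (8 : ℤ) ∣ ∑ ε : Fin 4 → Bool, e (fun j => x j ^^ decide (Odd #(univ.filter fun i => ε i && (![a₀, a₁, a₂, a₃] : Fin 4 → Fin (6 + 6) → Bool) i j))) at h8
  have hk : ∀ ε : Fin 4 → Bool, ∃ k : ℤ, e (fun j => x j ^^ decide (Odd #(univ.filter fun i => ε i && (![a₀, a₁, a₂, a₃] : Fin 4 → Fin (6 + 6) → Bool) i j))) =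
      sZ (hb (fun j => x j ^^ decide (Odd #(univ.filter fun i => ε i && (![a₀, a₁, a₂, a₃] : Fin 4 → Fin (6 + 6) → Bool) i j)))) + 8 * k := by
    intro ε
    obtain ⟨k, hk⟩ := h8on _ (hin ε)
    exact ⟨k, by simp only [e, hb]; linarith⟩
  choose k hk using hk
  rw [sum_congr rfl fun ε _ => hk ε, sum_add_distrib, ← mul_sum] at h8
  exact (dvd_add_left (Dvd.intro _ rfl)).1 h8

/-- **`M(y)² = 2048·S_R(y)`** on the odd hyperplane (`d0_Shat_sq` on the 11-flat; `hb` any Boolean function with base-free second differences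
along `V` on `P = x₀ ⊕ V`). [this work] -/
theorem tzl5_Shat_sq (u' : (Fin (6 + 6) → Bool) → ℤ) (V : Finset (Fin (6 + 6) → Bool)) (x₀ : Fin (6 + 6) → Bool) (h0 : zeroVec ∈ V)
    (hadd : ∀ a ∈ V, ∀ b ∈ V, bxor a b ∈ V) (hcardV : #V = 2048) (hP : (univ.filter fun x : Fin (6 + 6) → Bool => Odd (u' x)) = V.image (bxor x₀))
    (hb : (Fin (6 + 6) → Bool) → Bool)
    (hsd : ∀ x, Odd (u' x) → ∀ p ∈ V, ∀ q ∈ V, hb (bxor (bxor x p) q) =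
      (hb x ^^ hb (bxor x p) ^^ hb (bxor x q) ^^ (hb x₀ ^^ hb (bxor x₀ p) ^^ hb (bxor x₀ q) ^^ hb (bxor (bxor x₀ p) q))))
    (y : Fin (6 + 6) → Bool) :
    (∑ x ∈ (univ.filter fun x : Fin (6 + 6) → Bool => Odd (u' x)), signOf (hb x) * twist x y) ^ 2 =
      2048 * ∑ t ∈ (V.filter fun r => ∀ v ∈ V, (hb x₀ ^^ hb (bxor x₀ r) ^^ hb (bxor x₀ v) ^^ hb (bxor (bxor x₀ r) v)) = false),
        signOf (hb x₀ ^^ hb (bxor x₀ t)) * twist t y := by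
  classical
  set P := univ.filter (fun x : Fin (6 + 6) → Bool => Odd (u' x)) with hPdef
  have hmemP : ∀ x, x ∈ P ↔ Odd (u' x) := fun x => by simp [hPdef]
  have hx₀ : x₀ ∈ P := by rw [hP]; exact mem_image.2 ⟨zeroVec, h0, bxor_zeroVec x₀⟩
  have hVP : ∀ x, x ∈ P → bxor x₀ x ∈ V := fun x hx => fl1_coset_diff hP hx
  have hPV : ∀ x, x ∈ P → ∀ a ∈ V, bxor x a ∈ P := fun x hx a ha => fl1_coset_vadd hadd hP hx ha
  have hsd' : ∀ x, x ∈ P → ∀ p ∈ V, ∀ q ∈ V, hb (bxor (bxor x p) q) =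
      (hb x ^^ hb (bxor x p) ^^ hb (bxor x q) ^^ (hb x₀ ^^ hb (bxor x₀ p) ^^ hb (bxor x₀ q) ^^ hb (bxor (bxor x₀ p) q))) :=
    fun x hx => hsd x ((hmemP x).1 hx)
  have hPcard : #P = 2048 := by rw [hP, card_image_of_injective _ (iw_bxor_injective x₀), hcardV]
  set R := (V.filter fun r => ∀ v ∈ V, (hb x₀ ^^ hb (bxor x₀ r) ^^ hb (bxor x₀ v) ^^ hb (bxor (bxor x₀ r) v)) = false) with hR
  rw [sq, sum_mul_sum]
  have hrebase : ∀ x ∈ P, P = V.image (bxor x) := fun x hx => d0_rebase V P x₀ hadd hP hx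
  have hinner : ∀ x ∈ P, ∑ x' ∈ P, signOf (hb x) * twist x y * (signOf (hb x') * twist x' y) =
      ∑ t ∈ V, twist t y * (signOf (hb x) * signOf (hb (bxor x t))) := by
    intro x hx
    rw [hrebase x hx, sum_image (fun a _ b _ h => by
      have h' := congrArg (bxor x) h
      rwa [bxor_bxor_cancel_left, bxor_bxor_cancel_left] at h')]
    refine sum_congr rfl fun t _ => ?_
    rw [twist_bxor_left]
    have h1 := twist_mul_self x y
    linear_combination (signOf (hb x) * signOf (hb (bxor x t)) * twist t y) * h1
  rw [sum_congr rfl hinner, sum_comm]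
  rw [← sum_filter_add_sum_filter_not V (fun t => t ∈ R)]
  have e1 : V.filter (fun t => t ∈ R) = R := by
    ext t; simp only [mem_filter, hR]; exact ⟨fun h => h.2, fun h => ⟨h.1, h⟩⟩
  rw [e1]
  -- correlation along a non-radical direction vanishes
  have hcorr : ∀ t ∈ V, ∀ v ∈ V, (hb x₀ ^^ hb (bxor x₀ t) ^^ hb (bxor x₀ v) ^^ hb (bxor (bxor x₀ t) v)) = true →
      ∑ x ∈ P, signOf (hb x) * signOf (hb (bxor x t)) = 0 := by
    intro t ht v hv htv
    have hvt : (hb x₀ ^^ hb (bxor x₀ v) ^^ hb (bxor x₀ t) ^^ hb (bxor (bxor x₀ v) t)) = true := by rw [fr_B_symm x₀ hb v t]; exact htv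
    have hflip : ∀ x ∈ P, signOf (hb (bxor x v)) * signOf (hb (bxor (bxor x v) t)) = -(signOf (hb x) * signOf (hb (bxor x t))) := by
      intro x hx
      rw [hsd' x hx v hv t ht, hvt]
      cases hb x <;> cases hb (bxor x v) <;> cases hb (bxor x t) <;> simp [signOf]
    have h := gr20_sum_translate (S := P) (v := v) (fun x hx => hPV x hx v hv) (fun x => signOf (hb x) * signOf (hb (bxor x t)))
    rw [sum_congr rfl fun x hx => hflip x hx, sum_neg_distrib] at h
    linarith
  have hzero : ∑ t ∈ V.filter (fun t => t ∉ R), ∑ x ∈ P, twist t y * (signOf (hb x) * signOf (hb (bxor x t))) = 0 := by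
    refine sum_eq_zero fun t ht => ?_
    obtain ⟨htV, htR⟩ := mem_filter.1 ht
    have hex : ∃ v ∈ V, (hb x₀ ^^ hb (bxor x₀ t) ^^ hb (bxor x₀ v) ^^ hb (bxor (bxor x₀ t) v)) = true := by
      by_contra h
      push Not at h
      exact htR (mem_filter.2 ⟨htV, fun v hv => by simpa using h v hv⟩)
    obtain ⟨v, hv, htv⟩ := hex
    rw [← mul_sum, hcorr t htV v hv htv, mul_zero]
  rw [hzero, add_zero, mul_sum]
  refine sum_congr rfl fun t ht => ?_
  have hper : ∀ x ∈ P, hb (bxor x t) = (hb x ^^ (hb x₀ ^^ hb (bxor x₀ t))) :=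
    fun x hx => fr_radical_period V (· ∈ P) x₀ hb hx₀ hVP hsd' ht hx
  have hconst : ∀ x ∈ P, twist t y * (signOf (hb x) * signOf (hb (bxor x t))) = signOf (hb x₀ ^^ hb (bxor x₀ t)) * twist t y := by
    intro x hx
    rw [hper x hx]
    cases hb x <;> cases hb x₀ <;> cases hb (bxor x₀ t) <;> simp [signOf]
  rw [sum_congr rfl hconst, sum_const, hPcard, nsmul_eq_mul]
  push_cast
  ring

/-- **`S_R ∈ {0, #R}`** on the odd hyperplane (`η(r) = σ(x₀)σ(x₀⊕r)·(−1)^{r·y}` is multiplicative on the group `R`; `bd_hom_sum`). [this work] -/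
theorem tzl5_SR (u' : (Fin (6 + 6) → Bool) → ℤ) (V : Finset (Fin (6 + 6) → Bool)) (x₀ : Fin (6 + 6) → Bool) (h0 : zeroVec ∈ V)
    (hadd : ∀ a ∈ V, ∀ b ∈ V, bxor a b ∈ V) (hP : (univ.filter fun x : Fin (6 + 6) → Bool => Odd (u' x)) = V.image (bxor x₀))
    (hb : (Fin (6 + 6) → Bool) → Bool)
    (hsd : ∀ x, Odd (u' x) → ∀ p ∈ V, ∀ q ∈ V, hb (bxor (bxor x p) q) =
      (hb x ^^ hb (bxor x p) ^^ hb (bxor x q) ^^ (hb x₀ ^^ hb (bxor x₀ p) ^^ hb (bxor x₀ q) ^^ hb (bxor (bxor x₀ p) q))))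
    (y : Fin (6 + 6) → Bool) :
    ∑ t ∈ (V.filter fun r => ∀ v ∈ V, (hb x₀ ^^ hb (bxor x₀ r) ^^ hb (bxor x₀ v) ^^ hb (bxor (bxor x₀ r) v)) = false), signOf (hb x₀ ^^ hb (bxor x₀ t)) * twist t y = 0 ∨
    ∑ t ∈ (V.filter fun r => ∀ v ∈ V, (hb x₀ ^^ hb (bxor x₀ r) ^^ hb (bxor x₀ v) ^^ hb (bxor (bxor x₀ r) v)) = false), signOf (hb x₀ ^^ hb (bxor x₀ t)) * twist t y =
      #(V.filter fun r => ∀ v ∈ V, (hb x₀ ^^ hb (bxor x₀ r) ^^ hb (bxor x₀ v) ^^ hb (bxor (bxor x₀ r) v)) = false) := by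
  classical
  set P := univ.filter (fun x : Fin (6 + 6) → Bool => Odd (u' x)) with hPdef
  have hmemP : ∀ x, x ∈ P ↔ Odd (u' x) := fun x => by simp [hPdef]
  have hx₀P : x₀ ∈ P := by rw [hP]; exact mem_image.2 ⟨zeroVec, h0, bxor_zeroVec x₀⟩
  have hx₀ : Odd (u' x₀) := (hmemP x₀).1 hx₀P
  have hPV : ∀ x, Odd (u' x) → ∀ a ∈ V, Odd (u' (bxor x a)) := by
    intro x hx a ha
    have h := fl1_coset_vadd hadd hP (mem_filter.2 ⟨mem_univ _, hx⟩) ha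
    exact (mem_filter.1 h).2
  have hRadd := fr_radical_add V (fun z => Odd (u' z)) x₀ hb hx₀ hPV hadd hsd
  set R := (V.filter fun r => ∀ v ∈ V, (hb x₀ ^^ hb (bxor x₀ r) ^^ hb (bxor x₀ v) ^^ hb (bxor (bxor x₀ r) v)) = false) with hR
  have h1 : ∀ t ∈ R, signOf (hb x₀ ^^ hb (bxor x₀ t)) * twist t y = 1 ∨ signOf (hb x₀ ^^ hb (bxor x₀ t)) * twist t y = -1 := by
    intro t _
    rcases twist_eq_one_or t y with h | h <;> cases (hb x₀ ^^ hb (bxor x₀ t)) <;> simp [signOf, h]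
  have hmul : ∀ t ∈ R, ∀ s ∈ R,
      signOf (hb x₀ ^^ hb (bxor x₀ (bxor t s))) * twist (bxor t s) y = (signOf (hb x₀ ^^ hb (bxor x₀ t)) * twist t y) * (signOf (hb x₀ ^^ hb (bxor x₀ s)) * twist s y) := by
    intro t ht s hs
    have htV : t ∈ V := (mem_filter.1 ht).1
    have hsV : s ∈ V := (mem_filter.1 hs).1
    have hts : (hb x₀ ^^ hb (bxor x₀ t) ^^ hb (bxor x₀ s) ^^ hb (bxor (bxor x₀ t) s)) = false := (mem_filter.1 ht).2 s hsV
    rw [twist_bxor_left, ← iw_bxor_assoc x₀ t s, hsd x₀ hx₀ t htV s hsV, hts]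
    cases hb x₀ <;> cases hb (bxor x₀ t) <;> cases hb (bxor x₀ s) <;> simp [signOf]
  rcases bd_hom_sum R hRadd (fun t => signOf (hb x₀ ^^ hb (bxor x₀ t)) * twist t y) h1 hmul with h | h
  · exact Or.inl h
  · exact Or.inr h

/-- **The sign character sums of a generic level-5 side vanish or have square `≥ 2^20`, on at most `8` frequencies.**  Hypotheses: cubic `f, g`,
`W_g = 32u'`, `P = {u' odd} = x₀ ⊕ V` (`#V = 2048`), `4 ∣ e₅` off `P`, `8 ∣ e₅ − σ₅` on `P`, off-hyperplane energy `≤ 2047`.  Then for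
`M(y) = Σ_{x∈P} σ₅(x)(−1)^{x·y}`: every `M(y)` is `0` or has `M(y)² ≥ 2^20`, and `#{y : M(y) ≠ 0} ≤ 8`.  Finite-slice statement, NOT summit progress.
[this work] -/
theorem tzl5_M_struct (f g : (Fin (6 + 6) → Bool) → Bool) (hf : IsDegLeFun 3 f) (hg : IsDegLeFun 3 g)
    (u' : (Fin (6 + 6) → Bool) → ℤ) (hu' : ∀ x, W (fun y => signOf (g y)) x = (2 : ℝ) ^ 5 * (u' x : ℝ))
    (V : Finset (Fin (6 + 6) → Bool)) (x₀ : Fin (6 + 6) → Bool) (h0 : zeroVec ∈ V) (hadd : ∀ a ∈ V, ∀ b ∈ V, bxor a b ∈ V)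
    (hcardV : #V = 2048) (hP : (univ.filter fun x : Fin (6 + 6) → Bool => Odd (u' x)) = V.image (bxor x₀))
    (h4off : ∀ y, ¬ Odd (u' y) → (4 : ℤ) ∣ u' y - 2 * sZ (f y))
    (hoff : ∑ y ∈ univ.filter (fun y : Fin (6 + 6) → Bool => ¬ Odd (u' y)), (u' y - 2 * sZ (f y)) ^ 2 ≤ 2047)
    (h8on : ∀ x, Odd (u' x) → (8 : ℤ) ∣ u' x - 2 * sZ (f x) - sZ (decide ((u' x - 2 * sZ (f x)) % 4 = 3))) :
    (∀ y, ∑ x ∈ (univ.filter fun x : Fin (6 + 6) → Bool => Odd (u' x)), signOf (decide ((u' x - 2 * sZ (f x)) % 4 = 3)) * twist x y = 0 ∨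
      (2 : ℝ) ^ 20 ≤ (∑ x ∈ (univ.filter fun x : Fin (6 + 6) → Bool => Odd (u' x)), signOf (decide ((u' x - 2 * sZ (f x)) % 4 = 3)) * twist x y) ^ 2) ∧
    #(univ.filter fun y : Fin (6 + 6) → Bool =>
      ∑ x ∈ (univ.filter fun x : Fin (6 + 6) → Bool => Odd (u' x)), signOf (decide ((u' x - 2 * sZ (f x)) % 4 = 3)) * twist x y ≠ 0) ≤ 8 := by
  classical
  set P := univ.filter (fun x : Fin (6 + 6) → Bool => Odd (u' x)) with hPdef
  set hb : (Fin (6 + 6) → Bool) → Bool := fun x => decide ((u' x - 2 * sZ (f x)) % 4 = 3) with hbdef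
  have hmemP : ∀ x, x ∈ P ↔ Odd (u' x) := fun x => by simp [hPdef]
  have hx₀P : x₀ ∈ P := by rw [hP]; exact mem_image.2 ⟨zeroVec, h0, bxor_zeroVec x₀⟩
  have hx₀ : Odd (u' x₀) := (hmemP x₀).1 hx₀P
  have hPV : ∀ x, Odd (u' x) → ∀ a ∈ V, Odd (u' (bxor x a)) := by
    intro x hx a ha
    have h := fl1_coset_vadd hadd hP (mem_filter.2 ⟨mem_univ _, hx⟩) ha
    exact (mem_filter.1 h).2
  have hVP : ∀ x, Odd (u' x) → bxor x₀ x ∈ V := fun x hx => fl1_coset_diff hP (mem_filter.2 ⟨mem_univ _, hx⟩)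
  have hPcard : #P = 2048 := by rw [hP, card_image_of_injective _ (iw_bxor_injective x₀), hcardV]
  have hsd := tzl5_hsd f g hf hg u' hu' V x₀ h0 hadd hcardV hP h4off
  -- (H3)/(H4) for the sign, the radical is large
  have H3σ : ∀ x, Odd (u' x) → ∀ a b c : Fin (6 + 6) → Bool, a ∈ V → b ∈ V → c ∈ V →
      (4 : ℤ) ∣ ∑ ε : Fin 3 → Bool, sZ (hb (fun j => x j ^^ decide (Odd #(univ.filter fun i => ε i && (![a, b, c] : Fin 3 → Fin (6 + 6) → Bool) i j)))) := by
    intro x hx a b c ha hb' hc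
    have hin : ∀ ε : Fin 3 → Bool, Odd (u' (fun j => x j ^^ decide (Odd #(univ.filter fun i => ε i && (![a, b, c] : Fin 3 → Fin (6 + 6) → Bool) i j)))) :=
      fun ε => fr_mem_flatPt3 V h0 (fun z => Odd (u' z)) hPV hx _ (fun i => by fin_cases i <;> assumption) ε
    have h := tzl5_H3 f g hf hg u' hu' V x₀ h0 hadd hcardV hP h4off x hx a b c ha hb' hc
    have hk : ∀ ε : Fin 3 → Bool, ∃ k : ℤ, (u' (fun j => x j ^^ decide (Odd #(univ.filter fun i => ε i && (![a, b, c] : Fin 3 → Fin (6 + 6) → Bool) i j))) -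
        2 * sZ (f (fun j => x j ^^ decide (Odd #(univ.filter fun i => ε i && (![a, b, c] : Fin 3 → Fin (6 + 6) → Bool) i j))))) =
        sZ (hb (fun j => x j ^^ decide (Odd #(univ.filter fun i => ε i && (![a, b, c] : Fin 3 → Fin (6 + 6) → Bool) i j)))) + 8 * k :=
      fun ε => h8on _ (hin ε) |>.imp fun k hk => by simp only [hb]; linarith
    choose k hk using hk
    rw [sum_congr rfl fun ε _ => hk ε, sum_add_distrib, ← mul_sum] at h
    exact (dvd_add_left ((show (4 : ℤ) ∣ 8 from ⟨2, by norm_num⟩).trans (Dvd.intro _ rfl))).1 h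
  have H4σ := tzl5_sigma_H4 f g hf hg u' hu' V x₀ h0 hadd hcardV hP h4off hoff h8on
  have hRbig := fr_radical_large V (fun z => Odd (u' z)) x₀ hb hadd hx₀ hPV hVP H3σ H4σ
  set R := (V.filter fun r => ∀ v ∈ V, (hb x₀ ^^ hb (bxor x₀ r) ^^ hb (bxor x₀ v) ^^ hb (bxor (bxor x₀ r) v)) = false) with hR
  rw [hcardV] at hRbig
  have hRadd := fr_radical_add V (fun z => Odd (u' z)) x₀ hb hx₀ hPV hadd hsd
  have hR0 : zeroVec ∈ R := fr_radical_zero_mem V x₀ hb h0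
  obtain ⟨k, -, hk⟩ := sw_card_xorClosed R hR0 hRadd
  have hk9 : 9 ≤ k := by
    by_contra hlt
    push Not at hlt
    rw [hk] at hRbig
    interval_cases k <;> norm_num at hRbig
  set M : (Fin (6 + 6) → Bool) → ℝ := fun y => ∑ x ∈ P, signOf (hb x) * twist x y with hMdef
  have hvals : ∀ y, M y = 0 ∨ (2 : ℝ) ^ 20 ≤ M y ^ 2 := by
    intro y
    have hSq := tzl5_Shat_sq u' V x₀ h0 hadd hcardV hP hb hsd y
    rcases tzl5_SR u' V x₀ h0 hadd hP hb hsd y with h | h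
    · left
      rw [h, mul_zero] at hSq
      exact pow_eq_zero_iff two_ne_zero |>.1 hSq
    · right
      change M y ^ 2 = 2048 * _ at hSq
      rw [hSq, h, hk]
      push_cast
      have : (2 : ℝ) ^ 9 ≤ 2 ^ k := pow_le_pow_right₀ (by norm_num) hk9
      nlinarith
  refine ⟨hvals, ?_⟩
  -- Parseval: `Σ M² = 4096·2048 = 2^23`
  have hPars : ∑ y, M y ^ 2 = 2 ^ 23 := by
    set Sr : (Fin (6 + 6) → Bool) → ℝ := fun x => if x ∈ P then signOf (hb x) else 0 with hSr
    have hW : ∀ y, W Sr y = M y := by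
      intro y
      show ∑ x, Sr x * twist x y = ∑ x ∈ P, signOf (hb x) * twist x y
      rw [← sum_filter_add_sum_filter_not univ (fun x => x ∈ P)]
      have hz : ∑ x ∈ univ.filter (fun x => x ∉ P), Sr x * twist x y = 0 :=
        sum_eq_zero fun x hx => by simp only [Sr, if_neg (mem_filter.1 hx).2, zero_mul]
      rw [hz, add_zero]
      have ef : univ.filter (fun x => x ∈ P) = P := by ext x; simp
      rw [ef]
      exact sum_congr rfl fun x hx => by simp only [Sr, if_pos hx]
    have hP2 := sum_W_sq Sr
    simp_rw [hW] at hP2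
    rw [hP2]
    have hsq : ∑ x, Sr x ^ 2 = 2048 := by
      rw [← sum_filter_add_sum_filter_not univ (fun x => x ∈ P)]
      have hz : ∑ x ∈ univ.filter (fun x => x ∉ P), Sr x ^ 2 = 0 :=
        sum_eq_zero fun x hx => by simp only [Sr, if_neg (mem_filter.1 hx).2]; ring
      rw [hz, add_zero]
      have ef : univ.filter (fun x => x ∈ P) = P := by ext x; simp
      rw [ef]
      have h1 : ∀ x ∈ P, Sr x ^ 2 = 1 := fun x hx => by
        simp only [Sr, if_pos hx]; cases hb x <;> simp [signOf]
      rw [sum_congr rfl h1, sum_const, hPcard]; norm_num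
    rw [hsq]; norm_num
  have hpt : ∀ y, (if M y ≠ 0 then (2 : ℝ) ^ 20 else 0) ≤ M y ^ 2 := by
    intro y
    by_cases h : M y = 0
    · rw [if_neg (not_not.2 h), h]; norm_num
    · rw [if_pos h]; exact (hvals y).resolve_left h
  have hsum := sum_le_sum fun y (_ : y ∈ (univ : Finset (Fin (6 + 6) → Bool))) => hpt y
  rw [hPars, ← sum_filter, sum_const, nsmul_eq_mul] at hsum
  have h8 : (#(univ.filter fun y => M y ≠ 0) : ℝ) ≤ 8 := by nlinarith
  exact_mod_cast h8

end Summit.QuantumAdvantage.QuantumAdvantage.Theorems.CubicForrelation.NearExactIsExact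

end
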